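import Summits.CriticalPhenomena.CardyFormulaZ2.Theses.CardySelfRefinement
import Summits.CriticalPhenomena.CardyFormulaZ2.Theorems.CardySelfRefinementLagHandOffStopMeasurable
import HarnessLib

/-!
# Kernel gluing along shrinking stopping sets: partial helper for stub `stub_limitMarkov` (R2′)
# of line `hitting-tournament` for crux `LagHandOff` (stmt-CriticalPhenomena-10268)

The set-based domain Markov property (`ChordalFamily.IsMarkovExtension.markov`) asks ONE kernel
`Q` to disintegrate a law `P` on unparametrised curves along `γ ↦ (γ.stopAt F, γ.startFrom F)`
for EVERY closed `F`:  `P {stopAt F ∈ S, startFrom F ∈ T} = ∫⁻_{stopAt F ∈ S} Q (γ.stopAt F) T dP`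
(M_F).  For ONE `F` this is a tautology of disintegration (`exists_kernel_stopAt_startFrom`); for
ALL `F` with one `Q` ("stopping-set consistency") it is not (`no_markovKernel_twoSegments`), and
it is NOT a theorem of abstract disintegration theory either: two closed sets charge the common
pasts through the same event `{γ extends p}`, so their disintegrations agree a.e. PAIRWISE, but
the push-forward laws `(stopAt F)_* P`, `F` closed, are mutually singular across uncountably many
`F` with no dominating measure — a REGULARITY of the kernel along pasts is needed (the analogue
of Feller continuity / of the càdlàg version of Knight's prediction process).  This file turns
that regularity into the bookkeeping device the line needs:

* `tendsto_hitParam_iInter`, `tendsto_stopAt_iInter`, `tendsto_startFrom_iInter` — for closed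
  `F₀ ⊇ F₁ ⊇ ⋯` the first hitting parameter of `F_k` increases to that of `⋂ F_k` for EVERY curve,
  so the initial and final pieces at `F_k` converge to those at `⋂ F_k` (deterministic; no
  a.s.-continuity of `stopAt` — cf. `Negative/StopAtDiscontinuity.lean` — is involved).
* `lintegral_mul_comp_eq_of_markov` / `markov_of_forall_lintegral_mul_eq` — (M_F) in set form is
  equivalent to its weak form `∫ f(stopAt F) g(startFrom F) dP = ∫ f(stopAt F) Q(stopAt F)(g) dP`
  for bounded continuous `f, g ≥ 0` (`ext_of_forall_lintegral_eq_of_IsFiniteMeasure`, twice).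
* `markov_iInter_of_tendsto` — **kernel gluing**: if a measurable family of probability laws `Q`
  satisfies (M_{F_k}) along an antitone sequence of closed sets and is a.s. weakly continuous
  along the pasts `γ.stopAt F_k → γ.stopAt (⋂ F_k)`, then it satisfies (M_{⋂ F_k}) (dominated
  convergence on both sides of the weak form).  Registered form at `E = ℂ`:
  `stub_limitMarkov_kernelGluing`.  Hence the `markov` clause for ALL closed `F` follows from the
  clause on ANY class of closed sets approximating every closed set from outside (finite unions
  of closed rectangles, closed thickenings, …) plus left-continuity of the kernel along pasts
  (used in `…LagHandOffLimitMarkov.lean`).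

References: W. Werner, Lectures on two-dimensional critical percolation (2007) §3.2 (2);
F. B. Knight, Ann. Probab. 3 (1975) 573–596 (prediction process); P. Billingsley, Convergence of
probability measures (1999) §2 (finite Borel measures and bounded continuous functions).
-/

noncomputable section

open MeasureTheory ProbabilityTheory Filter Set Topology
open scoped BoundedContinuousFunction unitInterval ENNReal NNReal
open Literature.Probability.RandomPlanarGeometry

namespace Summit.CriticalPhenomena.CardyFormulaZ2.Cruxes.LagHandOff.HittingTournament

open Summit.CriticalPhenomena.CardyFormulaZ2.Cruxes.LagHandOff.CrosscutDictionary

section HitParam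

variable {E : Type*} [MetricSpace E]

/-- The first hitting parameter is antitone in the set: a bigger set is hit earlier. [folklore] -/
theorem hitParam_anti {F G : Set E} (h : F ⊆ G) (γ : Curve E) : γ.hitParam G ≤ γ.hitParam F := by
  unfold Curve.hitParam
  refine csInf_le_csInf ⟨0, fun _ ht => (γ.hitSet_subset_Icc G ht).1⟩ ⟨1, γ.one_mem_hitSet F⟩ ?_
  rintro t (⟨ht, hmem⟩ | ht)
  · exact Or.inl ⟨ht, h hmem⟩
  · exact Or.inr ht

/-- **Hitting parameters along shrinking closed sets.** For closed sets `F₀ ⊇ F₁ ⊇ ⋯` the first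
hitting parameter of `F_k` by a curve `γ` increases to the first hitting parameter of `⋂ F_k`:
the limit `L` of the increasing sequence satisfies `γ L ∈ F_j` for every `j` (closedness), so
`γ L ∈ ⋂ F_k` and `σ_{⋂ F_k} ≤ L`; if some `F_k` is never met both sides are `1`. [folklore] -/
theorem tendsto_hitParam_iInter {F : ℕ → Set E} (hF : ∀ k, IsClosed (F k)) (hanti : Antitone F)
    (γ : Curve E) :
    Tendsto (fun k => γ.hitParam (F k)) atTop (𝓝 (γ.hitParam (⋂ k, F k))) := by
  set u : ℕ → ℝ := fun k => γ.hitParam (F k) with hu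
  have hmono : Monotone u := fun k l hkl => hitParam_anti (hanti hkl) γ
  have hle : ∀ k, u k ≤ γ.hitParam (⋂ k, F k) := fun k => hitParam_anti (iInter_subset _ k) γ
  have hbdd : BddAbove (range u) := ⟨_, by rintro _ ⟨k, rfl⟩; exact hle k⟩
  have hconv : Tendsto u atTop (𝓝 (⨆ k, u k)) := tendsto_atTop_ciSup hmono hbdd
  suffices heq : (⨆ k, u k) = γ.hitParam (⋂ k, F k) by rwa [heq] at hconv
  refine le_antisymm (ciSup_le hle) ?_
  by_cases hmeet : ∀ k, ∃ t, γ t ∈ F k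
  · have hLI : (⨆ k, u k) ∈ Icc (0 : ℝ) 1 :=
      ⟨(γ.hitParam_mem_Icc (F 0)).1.trans (le_ciSup hbdd 0),
        ciSup_le fun k => (γ.hitParam_mem_Icc (F k)).2⟩
    have hmem : γ ⟨⨆ k, u k, hLI⟩ ∈ ⋂ k, F k := by
      refine mem_iInter.2 fun j => ?_
      have ht : Tendsto (fun k => (⟨u k, γ.hitParam_mem_Icc (F k)⟩ : I)) atTop
          (𝓝 ⟨⨆ k, u k, hLI⟩) := by rwa [tendsto_subtype_rng]
      have hγ : Tendsto (fun k => γ ⟨u k, γ.hitParam_mem_Icc (F k)⟩) atTop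
          (𝓝 (γ ⟨⨆ k, u k, hLI⟩)) :=
        (γ.continuous.tendsto _).comp ht
      refine (hF j).mem_of_tendsto hγ ?_
      filter_upwards [eventually_ge_atTop j] with k hk
      exact hanti hk (Curve.apply_hitParam_mem (hF k) (hmeet k))
    exact Curve.hitParam_le hmem
  · push Not at hmeet
    obtain ⟨k, hk⟩ := hmeet
    calc γ.hitParam (⋂ k, F k) ≤ 1 := (γ.hitParam_mem_Icc _).2
      _ = u k := (Curve.hitParam_eq_one_of_forall_notMem hk).symm
      _ ≤ ⨆ k, u k := le_ciSup hbdd k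

/-- Along shrinking closed sets the initial pieces of a parametrised curve converge (sup
metric, hence reparametrisation distance) to the piece at the intersection. [folklore] -/
theorem tendsto_curveStopAt_iInter {F : ℕ → Set E} (hF : ∀ k, IsClosed (F k)) (hanti : Antitone F)
    (γ : Curve E) : Tendsto (fun k => γ.stopAt (F k)) atTop (𝓝 (γ.stopAt (⋂ k, F k))) := by
  have hc : Continuous fun T : ℝ =>
      (⟨γ.toContinuousMap.comp (Curve.affineClamp 0 T)⟩ : Curve E) :=
    Curve.lipschitzWith_mk.continuous.comp
      (continuous_comp_affineClamp_stop.comp (continuous_const.prodMk continuous_id))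
  exact (hc.tendsto _).comp (tendsto_hitParam_iInter hF hanti γ)

/-- Along shrinking closed sets the final pieces of a parametrised curve converge to the final
piece at the intersection. [folklore] -/
theorem tendsto_curveStartFrom_iInter {F : ℕ → Set E} (hF : ∀ k, IsClosed (F k))
    (hanti : Antitone F) (γ : Curve E) :
    Tendsto (fun k => γ.startFrom (F k)) atTop (𝓝 (γ.startFrom (⋂ k, F k))) := by
  have hc : Continuous fun T : ℝ =>
      (⟨γ.toContinuousMap.comp (Curve.affineClamp T (1 - T))⟩ : Curve E) :=
    Curve.lipschitzWith_mk.continuous.comp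
      (continuous_comp_affineClamp_start.comp (continuous_const.prodMk continuous_id))
  exact (hc.tendsto _).comp (tendsto_hitParam_iInter hF hanti γ)

/-- **Initial pieces of a curve class along shrinking closed sets converge** to the initial piece
at the intersection (for every class; through the chosen representative). [folklore] -/
theorem tendsto_stopAt_iInter {F : ℕ → Set E} (hF : ∀ k, IsClosed (F k)) (hanti : Antitone F)
    (c : CurveClass E) :
    Tendsto (fun k => c.stopAt (F k)) atTop (𝓝 (c.stopAt (⋂ k, F k))) :=
  (CurveClass.continuous_mk.tendsto _).comp (tendsto_curveStopAt_iInter hF hanti c.out)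

/-- **Final pieces of a curve class along shrinking closed sets converge** to the final piece at
the intersection. [folklore] -/
theorem tendsto_startFrom_iInter {F : ℕ → Set E} (hF : ∀ k, IsClosed (F k)) (hanti : Antitone F)
    (c : CurveClass E) :
    Tendsto (fun k => c.startFrom (F k)) atTop (𝓝 (c.startFrom (⋂ k, F k))) :=
  (CurveClass.continuous_mk.tendsto _).comp (tendsto_curveStartFrom_iInter hF hanti c.out)

end HitParam

section WeakForm

variable {E : Type*} [MetricSpace E] [CompleteSpace E] [SecondCountableTopology E]

/-- **Set form ⇒ function form, in the future slot.** If `Q` disintegrates `P` at the closed set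
`G` (clause (M_G) for all Borel `S, T`), then for every Borel `S` and every measurable `g ≥ 0`,
`∫⁻_{stopAt G ∈ S} g (startFrom G γ) dP = ∫⁻_{stopAt G ∈ S} (∫⁻ g dQ (γ.stopAt G)) dP`
(the two measures `T ↦ P {stopAt G ∈ S, startFrom G ∈ T}` and
`T ↦ ∫⁻_{stopAt G ∈ S} Q (γ.stopAt G) T dP = bind` agree). [folklore] -/
theorem setLIntegral_comp_startFrom_eq_of_markov {P : Measure (CurveClass E)}
    {Q : CurveClass E → Measure (CurveClass E)}
    (hQm : ∀ T : Set (CurveClass E), MeasurableSet T → Measurable fun p => Q p T)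
    {G : Set E} (hG : IsClosed G)
    (hmk : ∀ S T : Set (CurveClass E), MeasurableSet S → MeasurableSet T →
      P (CurveClass.stopAt G ⁻¹' S ∩ CurveClass.startFrom G ⁻¹' T) =
        ∫⁻ γ in CurveClass.stopAt G ⁻¹' S, Q (γ.stopAt G) T ∂P)
    {S : Set (CurveClass E)} (hS : MeasurableSet S) {g : CurveClass E → ℝ≥0∞}
    (hg : Measurable g) :
    ∫⁻ γ in CurveClass.stopAt G ⁻¹' S, g (γ.startFrom G) ∂P =
      ∫⁻ γ in CurveClass.stopAt G ⁻¹' S, (∫⁻ x, g x ∂Q (γ.stopAt G)) ∂P := by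
  have hQ : Measurable Q := Measure.measurable_of_measurable_coe Q hQm
  have hs := measurable_stopAt (E := E) hG
  have hr := measurable_startFrom (E := E) hG
  have heq : (P.restrict (CurveClass.stopAt G ⁻¹' S)).map (CurveClass.startFrom G) =
      ((P.restrict (CurveClass.stopAt G ⁻¹' S)).map (CurveClass.stopAt G)).bind Q := by
    ext T hT
    rw [Measure.map_apply hr hT, Measure.restrict_apply (hr hT),
      Measure.bind_apply hT hQ.aemeasurable, lintegral_map (hQm T hT) hs, inter_comm]
    exact hmk S T hS hT
  calc ∫⁻ γ in CurveClass.stopAt G ⁻¹' S, g (γ.startFrom G) ∂P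
      = ∫⁻ y, g y ∂((P.restrict (CurveClass.stopAt G ⁻¹' S)).map (CurveClass.startFrom G)) :=
        (lintegral_map hg hr).symm
    _ = ∫⁻ y, g y ∂(((P.restrict (CurveClass.stopAt G ⁻¹' S)).map (CurveClass.stopAt G)).bind Q) := by
        rw [heq]
    _ = ∫⁻ p, (∫⁻ x, g x ∂Q p) ∂((P.restrict (CurveClass.stopAt G ⁻¹' S)).map (CurveClass.stopAt G)) :=
        Measure.lintegral_bind hQ.aemeasurable hg.aemeasurable
    _ = ∫⁻ γ in CurveClass.stopAt G ⁻¹' S, (∫⁻ x, g x ∂Q (γ.stopAt G)) ∂P :=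
        lintegral_map ((Measure.measurable_lintegral hg).comp hQ) hs

/-- **Set form ⇒ weak form.** If `Q` disintegrates `P` at the closed set `G`, then for all
measurable `f, g ≥ 0`,
`∫⁻ f (γ.stopAt G) g (γ.startFrom G) dP = ∫⁻ f (γ.stopAt G) (∫⁻ g dQ (γ.stopAt G)) dP`
(extension in the past slot: the measures `(g ∘ startFrom G) · P` and
`((∫⁻ g dQ) ∘ stopAt G) · P` have the same push-forward under `stopAt G`). [folklore] -/
theorem lintegral_mul_comp_eq_of_markov {P : Measure (CurveClass E)}
    {Q : CurveClass E → Measure (CurveClass E)}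
    (hQm : ∀ T : Set (CurveClass E), MeasurableSet T → Measurable fun p => Q p T)
    {G : Set E} (hG : IsClosed G)
    (hmk : ∀ S T : Set (CurveClass E), MeasurableSet S → MeasurableSet T →
      P (CurveClass.stopAt G ⁻¹' S ∩ CurveClass.startFrom G ⁻¹' T) =
        ∫⁻ γ in CurveClass.stopAt G ⁻¹' S, Q (γ.stopAt G) T ∂P)
    {f g : CurveClass E → ℝ≥0∞} (hf : Measurable f) (hg : Measurable g) :
    ∫⁻ γ, f (γ.stopAt G) * g (γ.startFrom G) ∂P =
      ∫⁻ γ, f (γ.stopAt G) * (∫⁻ x, g x ∂Q (γ.stopAt G)) ∂P := by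
  have hQ : Measurable Q := Measure.measurable_of_measurable_coe Q hQm
  have hs := measurable_stopAt (E := E) hG
  have hr := measurable_startFrom (E := E) hG
  have hG' : Measurable fun p => ∫⁻ x, g x ∂Q p := (Measure.measurable_lintegral hg).comp hQ
  have heq : (P.withDensity fun γ => g (γ.startFrom G)).map (CurveClass.stopAt G) =
      (P.withDensity fun γ => ∫⁻ x, g x ∂Q (γ.stopAt G)).map (CurveClass.stopAt G) := by
    ext S hS
    rw [Measure.map_apply hs hS, Measure.map_apply hs hS, withDensity_apply _ (hs hS),
      withDensity_apply _ (hs hS)]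
    exact setLIntegral_comp_startFrom_eq_of_markov hQm hG hmk hS hg
  calc ∫⁻ γ, f (γ.stopAt G) * g (γ.startFrom G) ∂P
      = ∫⁻ γ, ((fun γ : CurveClass E => g (γ.startFrom G)) *
          fun γ : CurveClass E => f (γ.stopAt G)) γ ∂P :=
        lintegral_congr fun γ => mul_comm _ _
    _ = ∫⁻ γ, f (γ.stopAt G) ∂(P.withDensity fun γ => g (γ.startFrom G)) :=
        (lintegral_withDensity_eq_lintegral_mul _ (hg.comp hr) (hf.comp hs)).symm
    _ = ∫⁻ p, f p ∂((P.withDensity fun γ => g (γ.startFrom G)).map (CurveClass.stopAt G)) :=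
        (lintegral_map hf hs).symm
    _ = ∫⁻ p, f p ∂((P.withDensity fun γ => ∫⁻ x, g x ∂Q (γ.stopAt G)).map
          (CurveClass.stopAt G)) := by rw [heq]
    _ = ∫⁻ γ, f (γ.stopAt G) ∂(P.withDensity fun γ => ∫⁻ x, g x ∂Q (γ.stopAt G)) :=
        lintegral_map hf hs
    _ = ∫⁻ γ, ((fun γ : CurveClass E => ∫⁻ x, g x ∂Q (γ.stopAt G)) *
          fun γ : CurveClass E => f (γ.stopAt G)) γ ∂P :=
        lintegral_withDensity_eq_lintegral_mul _ (hG'.comp hs) (hf.comp hs)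
    _ = ∫⁻ γ, f (γ.stopAt G) * (∫⁻ x, g x ∂Q (γ.stopAt G)) ∂P :=
        lintegral_congr fun γ => mul_comm _ _

/-- **Weak form ⇒ set form.** If `Q` is a measurable family of laws and the weak
identity `∫⁻ f (γ.stopAt G) g (γ.startFrom G) dP = ∫⁻ f (γ.stopAt G) (∫⁻ g dQ (γ.stopAt G)) dP`
holds for all bounded continuous `f, g ≥ 0`, then `Q` disintegrates the finite measure `P` at the
closed set `G` (clause (M_G) for all Borel `S, T`).  Finite Borel measures on the metric space of
curve classes are determined by the integrals of bounded continuous functions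
(`ext_of_forall_lintegral_eq_of_IsFiniteMeasure`), applied first in the past slot for fixed `g`,
then in the future slot for fixed `S`. [folklore] -/
theorem markov_of_forall_lintegral_mul_eq {P : Measure (CurveClass E)} [IsFiniteMeasure P]
    {Q : CurveClass E → Measure (CurveClass E)}
    (hQm : ∀ T : Set (CurveClass E), MeasurableSet T → Measurable fun p => Q p T)
    {G : Set E} (hG : IsClosed G)
    (hweak : ∀ f g : CurveClass E →ᵇ ℝ≥0,
      ∫⁻ γ, f (γ.stopAt G) * g (γ.startFrom G) ∂P =
        ∫⁻ γ, f (γ.stopAt G) * (∫⁻ x, g x ∂Q (γ.stopAt G)) ∂P) :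
    ∀ S T : Set (CurveClass E), MeasurableSet S → MeasurableSet T →
      P (CurveClass.stopAt G ⁻¹' S ∩ CurveClass.startFrom G ⁻¹' T) =
        ∫⁻ γ in CurveClass.stopAt G ⁻¹' S, Q (γ.stopAt G) T ∂P := by
  have hQ : Measurable Q := Measure.measurable_of_measurable_coe Q hQm
  have hs := measurable_stopAt (E := E) hG
  have hr := measurable_startFrom (E := E) hG
  intro S T hS hT
  -- Step 1: extension in the past slot, for every bounded continuous `g ≥ 0`.
  have step1 : ∀ g : CurveClass E →ᵇ ℝ≥0,
      ∫⁻ γ in CurveClass.stopAt G ⁻¹' S, (g (γ.startFrom G) : ℝ≥0∞) ∂P =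
        ∫⁻ γ in CurveClass.stopAt G ⁻¹' S, (∫⁻ x, g x ∂Q (γ.stopAt G)) ∂P := by
    intro g
    have hgm : Measurable fun x => (g x : ℝ≥0∞) := g.measurable_coe_ennreal_comp
    have hG' : Measurable fun p => ∫⁻ x, g x ∂Q p := (Measure.measurable_lintegral hgm).comp hQ
    have hfin : ∫⁻ γ, (g (γ.startFrom G) : ℝ≥0∞) ∂P ≠ ∞ :=
      (IsFiniteMeasure.lintegral_lt_top_of_bounded_to_ennreal P
        ⟨nndist g 0, fun γ => ENNReal.coe_le_coe.2 (BoundedContinuousFunction.NNReal.upper_bound g _)⟩).ne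
    haveI : IsFiniteMeasure (P.withDensity fun γ => (g (γ.startFrom G) : ℝ≥0∞)) :=
      isFiniteMeasure_withDensity hfin
    have heq : (P.withDensity fun γ => (g (γ.startFrom G) : ℝ≥0∞)).map (CurveClass.stopAt G) =
        (P.withDensity fun γ => ∫⁻ x, g x ∂Q (γ.stopAt G)).map (CurveClass.stopAt G) := by
      refine ext_of_forall_lintegral_eq_of_IsFiniteMeasure fun f => ?_
      have hfm : Measurable fun x => (f x : ℝ≥0∞) := f.measurable_coe_ennreal_comp
      calc ∫⁻ p, (f p : ℝ≥0∞)
            ∂(P.withDensity fun γ => (g (γ.startFrom G) : ℝ≥0∞)).map (CurveClass.stopAt G)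
          = ∫⁻ γ, (f (γ.stopAt G) : ℝ≥0∞)
              ∂(P.withDensity fun γ => (g (γ.startFrom G) : ℝ≥0∞)) := lintegral_map hfm hs
        _ = ∫⁻ γ, ((fun γ : CurveClass E => (g (γ.startFrom G) : ℝ≥0∞)) *
              fun γ : CurveClass E => (f (γ.stopAt G) : ℝ≥0∞)) γ ∂P :=
            lintegral_withDensity_eq_lintegral_mul _ (hgm.comp hr) (hfm.comp hs)
        _ = ∫⁻ γ, f (γ.stopAt G) * g (γ.startFrom G) ∂P :=
            lintegral_congr fun γ => by rw [Pi.mul_apply, mul_comm]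
        _ = ∫⁻ γ, f (γ.stopAt G) * (∫⁻ x, g x ∂Q (γ.stopAt G)) ∂P := hweak f g
        _ = ∫⁻ γ, ((fun γ : CurveClass E => ∫⁻ x, g x ∂Q (γ.stopAt G)) *
              fun γ : CurveClass E => (f (γ.stopAt G) : ℝ≥0∞)) γ ∂P :=
            lintegral_congr fun γ => mul_comm _ _
        _ = ∫⁻ γ, (f (γ.stopAt G) : ℝ≥0∞)
              ∂(P.withDensity fun γ => ∫⁻ x, g x ∂Q (γ.stopAt G)) :=
            (lintegral_withDensity_eq_lintegral_mul _ (hG'.comp hs) (hfm.comp hs)).symm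
        _ = ∫⁻ p, (f p : ℝ≥0∞)
              ∂(P.withDensity fun γ => ∫⁻ x, g x ∂Q (γ.stopAt G)).map (CurveClass.stopAt G) :=
            (lintegral_map hfm hs).symm
    have h : ((P.withDensity fun γ => (g (γ.startFrom G) : ℝ≥0∞)).map (CurveClass.stopAt G)) S =
        ((P.withDensity fun γ => ∫⁻ x, g x ∂Q (γ.stopAt G)).map (CurveClass.stopAt G)) S := by
      rw [heq]
    rwa [Measure.map_apply hs hS, Measure.map_apply hs hS, withDensity_apply _ (hs hS),
      withDensity_apply _ (hs hS)] at h
  -- Step 2: extension in the future slot, for the fixed Borel `S`.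
  have heq2 : (P.restrict (CurveClass.stopAt G ⁻¹' S)).map (CurveClass.startFrom G) =
      ((P.restrict (CurveClass.stopAt G ⁻¹' S)).map (CurveClass.stopAt G)).bind Q := by
    refine ext_of_forall_lintegral_eq_of_IsFiniteMeasure fun g => ?_
    have hgm : Measurable fun x => (g x : ℝ≥0∞) := g.measurable_coe_ennreal_comp
    have hG' : Measurable fun p => ∫⁻ x, g x ∂Q p := (Measure.measurable_lintegral hgm).comp hQ
    rw [lintegral_map hgm hr, Measure.lintegral_bind hQ.aemeasurable hgm.aemeasurable,
      lintegral_map hG' hs]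
    exact step1 g
  calc P (CurveClass.stopAt G ⁻¹' S ∩ CurveClass.startFrom G ⁻¹' T)
      = (P.restrict (CurveClass.stopAt G ⁻¹' S)).map (CurveClass.startFrom G) T := by
        rw [Measure.map_apply hr hT, Measure.restrict_apply (hr hT), inter_comm]
    _ = ((P.restrict (CurveClass.stopAt G ⁻¹' S)).map (CurveClass.stopAt G)).bind Q T := by
        rw [heq2]
    _ = ∫⁻ γ in CurveClass.stopAt G ⁻¹' S, Q (γ.stopAt G) T ∂P := by
        rw [Measure.bind_apply hT hQ.aemeasurable, lintegral_map (hQm T hT) hs]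

end WeakForm

section Gluing

variable {E : Type*} [MetricSpace E] [CompleteSpace E] [SecondCountableTopology E]

/-- **Kernel gluing along shrinking stopping sets.** Let `P` be a finite law on curve classes and
`Q` a measurable family of probability laws (the candidate conditional laws of the future given
the explored initial piece).  If `Q` disintegrates `P` at every closed set of an antitone sequence
`F₀ ⊇ F₁ ⊇ ⋯` (clauses (M_{F_k})) and is `P`-a.s. weakly left-continuous along the pasts
`γ.stopAt F_k → γ.stopAt (⋂ F_k)`, then `Q` disintegrates `P` at `⋂ F_k`.  Proof: in the weak
form of (M_{F_k}) both sides converge by dominated convergence — the left because the initial and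
final pieces at `F_k` converge for EVERY curve class (`tendsto_stopAt_iInter`,
`tendsto_startFrom_iInter`), the right by the continuity hypothesis — and the weak form at `⋂ F_k`
is equivalent to the set form (`markov_of_forall_lintegral_mul_eq`). [folklore] -/
theorem markov_iInter_of_tendsto (P : Measure (CurveClass E)) [IsFiniteMeasure P]
    (Q : CurveClass E → Measure (CurveClass E)) (hprob : ∀ p, IsProbabilityMeasure (Q p))
    (hQm : ∀ T : Set (CurveClass E), MeasurableSet T → Measurable fun p => Q p T)
    {F : ℕ → Set E} (hF : ∀ k, IsClosed (F k)) (hanti : Antitone F)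
    (hmarkov : ∀ k, ∀ S T : Set (CurveClass E), MeasurableSet S → MeasurableSet T →
      P (CurveClass.stopAt (F k) ⁻¹' S ∩ CurveClass.startFrom (F k) ⁻¹' T) =
        ∫⁻ γ in CurveClass.stopAt (F k) ⁻¹' S, Q (γ.stopAt (F k)) T ∂P)
    (hcont : ∀ g : CurveClass E →ᵇ ℝ, ∀ᵐ γ ∂P,
      Tendsto (fun k => ∫ x, g x ∂Q (γ.stopAt (F k))) atTop
        (𝓝 (∫ x, g x ∂Q (γ.stopAt (⋂ k, F k))))) :
    ∀ S T : Set (CurveClass E), MeasurableSet S → MeasurableSet T →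
      P (CurveClass.stopAt (⋂ k, F k) ⁻¹' S ∩ CurveClass.startFrom (⋂ k, F k) ⁻¹' T) =
        ∫⁻ γ in CurveClass.stopAt (⋂ k, F k) ⁻¹' S, Q (γ.stopAt (⋂ k, F k)) T ∂P := by
  have hQ : Measurable Q := Measure.measurable_of_measurable_coe Q hQm
  refine markov_of_forall_lintegral_mul_eq hQm (isClosed_iInter hF) fun f g => ?_
  have hfm : Measurable fun x => (f x : ℝ≥0∞) := f.measurable_coe_ennreal_comp
  have hgm : Measurable fun x => (g x : ℝ≥0∞) := g.measurable_coe_ennreal_comp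
  have hG' : Measurable fun p => ∫⁻ x, g x ∂Q p := (Measure.measurable_lintegral hgm).comp hQ
  -- the real-valued copy of `g`, and `∫⁻ g dQ p = ofReal (∫ g dQ p)`
  set gR : CurveClass E →ᵇ ℝ :=
    ⟨⟨fun x => (g x : ℝ), NNReal.continuous_coe.comp g.continuous⟩, g.map_bounded'⟩ with hgR
  have hGeq : ∀ p, ∫⁻ x, g x ∂Q p = ENNReal.ofReal (∫ x, gR x ∂Q p) := by
    intro p
    rw [← ENNReal.ofReal_toReal (BoundedContinuousFunction.lintegral_lt_top_of_nnreal (Q p) g).ne,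
      BoundedContinuousFunction.toReal_lintegral_coe_eq_integral]
    rfl
  -- uniform bounds
  have hfle : ∀ x, (f x : ℝ≥0∞) ≤ nndist f 0 := fun x =>
    ENNReal.coe_le_coe.2 (BoundedContinuousFunction.NNReal.upper_bound f x)
  have hgle : ∀ x, (g x : ℝ≥0∞) ≤ nndist g 0 := fun x =>
    ENNReal.coe_le_coe.2 (BoundedContinuousFunction.NNReal.upper_bound g x)
  have hG'le : ∀ p, ∫⁻ x, g x ∂Q p ≤ nndist g 0 := fun p =>
    (lintegral_mono (hgle ·)).trans (by rw [lintegral_const, measure_univ, mul_one])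
  have hbound : ∫⁻ _ : CurveClass E, (nndist f 0 : ℝ≥0∞) * nndist g 0 ∂P ≠ ∞ := by
    rw [lintegral_const]
    exact ENNReal.mul_ne_top (ENNReal.mul_ne_top ENNReal.coe_ne_top ENNReal.coe_ne_top)
      (measure_ne_top P _)
  -- the left-hand sides of the weak identities converge (for EVERY curve class)
  have hL : Tendsto (fun k => ∫⁻ γ, f (γ.stopAt (F k)) * g (γ.startFrom (F k)) ∂P) atTop
      (𝓝 (∫⁻ γ, f (γ.stopAt (⋂ k, F k)) * g (γ.startFrom (⋂ k, F k)) ∂P)) := by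
    refine tendsto_lintegral_of_dominated_convergence (fun _ => (nndist f 0 : ℝ≥0∞) * nndist g 0)
      (fun k => (hfm.comp (measurable_stopAt (hF k))).mul
        (hgm.comp (measurable_startFrom (hF k))))
      (fun k => Eventually.of_forall fun γ => mul_le_mul' (hfle _) (hgle _)) hbound
      (Eventually.of_forall fun γ => ?_)
    have h1 : Tendsto (fun k => (f (γ.stopAt (F k)) : ℝ≥0∞)) atTop
        (𝓝 (f (γ.stopAt (⋂ k, F k)))) :=
      ((ENNReal.continuous_coe.comp f.continuous).tendsto _).comp (tendsto_stopAt_iInter hF hanti γ)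
    have h2 : Tendsto (fun k => (g (γ.startFrom (F k)) : ℝ≥0∞)) atTop
        (𝓝 (g (γ.startFrom (⋂ k, F k)))) :=
      ((ENNReal.continuous_coe.comp g.continuous).tendsto _).comp
        (tendsto_startFrom_iInter hF hanti γ)
    exact ENNReal.Tendsto.mul h1 (Or.inr ENNReal.coe_ne_top) h2 (Or.inr ENNReal.coe_ne_top)
  -- the right-hand sides converge (a.e., by the continuity hypothesis on the real copy of `g`)
  have hR : Tendsto (fun k => ∫⁻ γ, f (γ.stopAt (F k)) * (∫⁻ x, g x ∂Q (γ.stopAt (F k))) ∂P)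
      atTop (𝓝 (∫⁻ γ, f (γ.stopAt (⋂ k, F k)) * (∫⁻ x, g x ∂Q (γ.stopAt (⋂ k, F k))) ∂P)) := by
    refine tendsto_lintegral_of_dominated_convergence (fun _ => (nndist f 0 : ℝ≥0∞) * nndist g 0)
      (fun k => (hfm.comp (measurable_stopAt (hF k))).mul (hG'.comp (measurable_stopAt (hF k))))
      (fun k => Eventually.of_forall fun γ => mul_le_mul' (hfle _) (hG'le _)) hbound ?_
    filter_upwards [hcont gR] with γ hγ
    have h1 : Tendsto (fun k => (f (γ.stopAt (F k)) : ℝ≥0∞)) atTop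
        (𝓝 (f (γ.stopAt (⋂ k, F k)))) :=
      ((ENNReal.continuous_coe.comp f.continuous).tendsto _).comp (tendsto_stopAt_iInter hF hanti γ)
    have h2 : Tendsto (fun k => ∫⁻ x, g x ∂Q (γ.stopAt (F k))) atTop
        (𝓝 (∫⁻ x, g x ∂Q (γ.stopAt (⋂ k, F k)))) := by
      simp only [hGeq]
      exact ENNReal.tendsto_ofReal hγ
    exact ENNReal.Tendsto.mul h1 (Or.inr ((hG'le _).trans_lt ENNReal.coe_lt_top).ne) h2
      (Or.inr ENNReal.coe_ne_top)
  -- the two sides agree for every `k`, hence in the limit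
  have heqk : ∀ k, ∫⁻ γ, f (γ.stopAt (F k)) * g (γ.startFrom (F k)) ∂P =
      ∫⁻ γ, f (γ.stopAt (F k)) * (∫⁻ x, g x ∂Q (γ.stopAt (F k))) ∂P := fun k =>
    lintegral_mul_comp_eq_of_markov hQm (hF k) (hmarkov k) hfm hgm
  exact tendsto_nhds_unique hL (hR.congr fun k => (heqk k).symm)

/-- **Registered sub-goal `stub_limitMarkov_kernelGluing` of `stub_limitMarkov` (R2′)**: kernel
gluing for laws of planar curve classes (`markov_iInter_of_tendsto` at `E = ℂ`) — the `markov`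
clause of `ChordalFamily.IsMarkovExtension` at `⋂ F_k` follows from the clauses at the closed sets
`F₀ ⊇ F₁ ⊇ ⋯` for a measurable family of probability laws that is a.s. weakly left-continuous
along the pasts `γ.stopAt F_k`. [folklore] -/
theorem stub_limitMarkov_kernelGluing : ∀ (P : Measure (CurveClass ℂ)) [IsFiniteMeasure P] (Q : CurveClass ℂ → Measure (CurveClass ℂ)), (∀ p, IsProbabilityMeasure (Q p)) → (∀ T : Set (CurveClass ℂ), MeasurableSet T → Measurable fun p => Q p T) → ∀ F : ℕ → Set ℂ, (∀ k, IsClosed (F k)) → Antitone F → (∀ k, ∀ S T : Set (CurveClass ℂ), MeasurableSet S → MeasurableSet T → P (CurveClass.stopAt (F k) ⁻¹' S ∩ CurveClass.startFrom (F k) ⁻¹' T) = ∫⁻ γ in CurveClass.stopAt (F k) ⁻¹' S, Q (γ.stopAt (F k)) T ∂P) → (∀ g : CurveClass ℂ →ᵇ ℝ, ∀ᵐ γ ∂P, Tendsto (fun k => ∫ x, g x ∂(Q (γ.stopAt (F k)))) atTop (𝓝 (∫ x, g x ∂(Q (γ.stopAt (⋂ k, F k)))))) → ∀ S T : Set (CurveClass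 ℂ), MeasurableSet S → MeasurableSet T → P (CurveClass.stopAt (⋂ k, F k) ⁻¹' S ∩ CurveClass.startFrom (⋂ k, F k) ⁻¹' T) = ∫⁻ γ in CurveClass.stopAt (⋂ k, F k) ⁻¹' S, Q (γ.stopAt (⋂ k, F k)) T ∂P :=
  fun P _ Q hprob hQm _ hF hanti hmarkov hcont =>
    markov_iInter_of_tendsto P Q hprob hQm hF hanti hmarkov hcont

end Gluing

end Summit.CriticalPhenomena.CardyFormulaZ2.Cruxes.LagHandOff.HittingTournament

end
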